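import Literature.RingTheory.Flat.FibrewiseCriterionLemmas
import Mathlib.RingTheory.MvPolynomial.Basic
import HarnessLib

/-!
# The fibre rings in the limit argument for the fibrewise criterion (Stacks 00R7, 05UV)

Two book-keeping steps of the limit argument proving the named fact `Stacks05UV` (The Stacks
Project, Tags 00R7/05UV) from its Noetherian form (Tag 00MP,
`Literature/RingTheory/Flat/FibrewiseCriterionLevel.lean`). Notation: `(R, 𝔪, k)` a local ring,
`T ⊆ R` a subring with `𝔭 = 𝔪 ∩ T = Ker(T → k)`, `C` a `T`-algebra generated by `x₁, …, xₙ`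
with relations containing `g₁, …, g_s ∈ T[x]`, `Λ = C/𝔭C` the level-`T` fibre ring, `Λ₀` a
`k`-algebra under `C` (in the application `Λ₀ = B/𝔪B`).

* `flat_of_fibre_generators` — **`Λ₀` is flat over `Λ`** as soon as `k[x] → Λ₀` is onto with
  kernel contained in `(ḡ₁, …, ḡ_s)`: then `Λ ⊗_{T/𝔭} k → Λ₀` is bijective (its composite with
  the surjection `k[x] → Λ ⊗_{T/𝔭} k` is `k[x] → Λ₀`, whose kernel dies in `Λ ⊗_{T/𝔭} k`), and
  `Λ ⊗_{T/𝔭} k` is flat over `Λ` because the field `k` is flat over the domain `T/𝔭 ⊆ k`. (This is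
  "`S/𝔪S = colim S_λ/𝔭_λS_λ`" of Tag 00R7 made effective: the fibre ring at level `∞` is the base
  change of the level-`T` fibre ring once the `g_j` generate the fibre ideal.)
* `isPushout_quotient_comp` — pasting of pushout squares: if `B′ = R ⊗_T P` then
  `B′/𝔪B′ = k ⊗_T P` ("`S′/𝔪S′ = colim S′_λ/𝔭_λS′_λ`").

## References

* The Stacks Project, Tags 00R7, 05UV. [StacksProject]
-/

universe u v w u'

open TensorProduct MvPolynomial

namespace Literature.RingTheory.Flat

/-! ### Flatness of the fibre ring at level `∞` over the fibre ring at level `T` -/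

section FibreFlat

variable {T : Type u} [CommRing T] (p : Ideal T) [p.IsPrime]
  {k : Type v} [Field k] [Algebra T k] (hk : ∀ t, algebraMap T k t = 0 ↔ t ∈ p)
  {n s : ℕ} (gT : Fin s → MvPolynomial (Fin n) T)
  {C : Type w} [CommRing C] [Algebra T C] (mkC : MvPolynomial (Fin n) T →ₐ[T] C)
  (hmkC : Function.Surjective mkC) (hgT : ∀ l, mkC (gT l) = 0)
  {Λ₀ : Type u'} [CommRing Λ₀] [Algebra k Λ₀] [Algebra T Λ₀] [IsScalarTower T k Λ₀]
  [Algebra C Λ₀] [IsScalarTower T C Λ₀]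
  [Algebra (C ⧸ p.map (algebraMap T C)) Λ₀] [IsScalarTower C (C ⧸ p.map (algebraMap T C)) Λ₀]

include hk hmkC hgT in
/-- **The fibre ring at level `∞` is flat over the fibre ring at level `T`.** Let `𝔭 ⊆ T` be a
prime, `k` a field under `T` with `Ker(T → k) = 𝔭`, `C` a `T`-algebra with a surjection
`T[x₁, …, xₙ] → C` killing `g₁, …, g_s`, `Λ = C/𝔭C`, and `Λ₀` a `k`-algebra under `C` (compatibly
with `T`, through `Λ`). If `k[x] → Λ₀` (`xᵢ ↦ xᵢ`) is onto with kernel inside `(ḡ₁, …, ḡ_s)`,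
then `Λ₀` is flat over `Λ`: `Λ ⊗_{T/𝔭} k → Λ₀` is bijective and `k` is flat over the domain
`T/𝔭 ⊆ k`. [cite: StacksProject, Tag 00R7 (proof)] -/
theorem flat_of_fibre_generators
    (hgen : Function.Surjective
      (MvPolynomial.eval₂Hom (algebraMap k Λ₀) fun i => algebraMap C Λ₀ (mkC (X i))))
    (hker : RingHom.ker (MvPolynomial.eval₂Hom (algebraMap k Λ₀) fun i => algebraMap C Λ₀ (mkC (X i)))
      ≤ Ideal.span (Set.range fun l => MvPolynomial.map (algebraMap T k) (gT l))) :
    Module.Flat (C ⧸ p.map (algebraMap T C)) Λ₀ := by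
  let Λ := C ⧸ p.map (algebraMap T C)
  let T₀ := T ⧸ p
  -- `T₀ = T/𝔭 ⊆ k`, and `k` is flat over the domain `T₀`
  have hpk : ∀ t ∈ p, algebraMap T k t = 0 := fun t ht => (hk t).mpr ht
  letI : Algebra T₀ k := (Ideal.Quotient.lift p (algebraMap T k) hpk).toAlgebra
  haveI : IsScalarTower T T₀ k :=
    IsScalarTower.of_algebraMap_eq fun t => (Ideal.Quotient.lift_mk p (algebraMap T k) hpk).symm
  have hinj : Function.Injective (algebraMap T₀ k) := by
    rw [injective_iff_map_eq_zero]
    intro t ht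
    obtain ⟨t, rfl⟩ := Ideal.Quotient.mk_surjective t
    rw [Ideal.Quotient.eq_zero_iff_mem, ← hk]
    rwa [← Ideal.Quotient.algebraMap_eq, ← IsScalarTower.algebraMap_apply] at ht
  haveI : Module.Flat T₀ k := by
    haveI : FaithfulSMul T₀ k := (faithfulSMul_iff_algebraMap_injective T₀ k).mpr hinj
    letI : Algebra (FractionRing T₀) k := FractionRing.liftAlgebra T₀ k
    haveI : Module.Flat T₀ (FractionRing T₀) :=
      IsLocalization.flat (FractionRing T₀) (nonZeroDivisors T₀)
    exact Module.Flat.trans T₀ (FractionRing T₀) k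
  -- `Λ₀` as a `T₀`-algebra through `k`, compatibly with `Λ`
  letI : Algebra T₀ Λ₀ := ((algebraMap k Λ₀).comp (algebraMap T₀ k)).toAlgebra
  haveI : IsScalarTower T₀ k Λ₀ := IsScalarTower.of_algebraMap_eq fun _ => rfl
  have hTΛ₀ : ∀ t : T, algebraMap T₀ Λ₀ (Ideal.Quotient.mk p t) = algebraMap T Λ₀ t := fun t => by
    change algebraMap k Λ₀ (Ideal.Quotient.lift p (algebraMap T k) hpk (Ideal.Quotient.mk p t)) = _
    rw [Ideal.Quotient.lift_mk, ← IsScalarTower.algebraMap_apply]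
  have hTΛ : ∀ t : T, algebraMap Λ Λ₀ (algebraMap T₀ Λ (Ideal.Quotient.mk p t)) =
      algebraMap T Λ₀ t := fun t => by
    rw [Ideal.Quotient.algebraMap_quotient_map_quotient, ← Ideal.Quotient.algebraMap_eq,
      ← IsScalarTower.algebraMap_apply, ← IsScalarTower.algebraMap_apply]
  haveI : IsScalarTower T₀ Λ Λ₀ := IsScalarTower.of_algebraMap_eq fun t => by
    obtain ⟨t, rfl⟩ := Ideal.Quotient.mk_surjective t
    rw [hTΛ₀, hTΛ]
  -- the comparison map `ψ : Λ ⊗_{T₀} k → Λ₀`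
  let M := Λ ⊗[T₀] k
  let ψ : M →ₐ[T₀] Λ₀ := Algebra.TensorProduct.lift (IsScalarTower.toAlgHom T₀ Λ Λ₀)
    (IsScalarTower.toAlgHom T₀ k Λ₀) fun _ _ => Commute.all _ _
  have hψ : ∀ (a : Λ) (b : k), ψ (a ⊗ₜ[T₀] b) = algebraMap Λ Λ₀ a * algebraMap k Λ₀ b :=
    fun a b => Algebra.TensorProduct.lift_tmul _ _ _ a b
  -- `α : k[x] → Λ ⊗ k` and `β = ψ ∘ α : k[x] → Λ₀`
  let xs : Fin n → Λ := fun i => algebraMap C Λ (mkC (X i))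
  let α : MvPolynomial (Fin n) k →+* M :=
    MvPolynomial.eval₂Hom (Algebra.TensorProduct.includeRight (R := T₀) (A := Λ) (B := k)).toRingHom
      fun i => xs i ⊗ₜ[T₀] (1 : k)
  let β : MvPolynomial (Fin n) k →+* Λ₀ :=
    MvPolynomial.eval₂Hom (algebraMap k Λ₀) fun i => algebraMap C Λ₀ (mkC (X i))
  have hψα : ψ.toRingHom.comp α = β := by
    refine MvPolynomial.ringHom_ext (fun a => ?_) (fun i => ?_)
    · change ψ (α (MvPolynomial.C a)) = β (MvPolynomial.C a)
      rw [MvPolynomial.eval₂Hom_C, MvPolynomial.eval₂Hom_C]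
      change ψ ((1 : Λ) ⊗ₜ[T₀] a) = _
      rw [hψ, map_one, one_mul]
    · change ψ (α (MvPolynomial.X i)) = β (MvPolynomial.X i)
      rw [MvPolynomial.eval₂Hom_X', MvPolynomial.eval₂Hom_X', hψ, map_one, mul_one]
      exact (IsScalarTower.algebraMap_apply C Λ Λ₀ _).symm
  -- `α` on polynomials coming from `T[x]`
  have hαmap : ∀ q : MvPolynomial (Fin n) T,
      α (MvPolynomial.map (algebraMap T k) q) = algebraMap C Λ (mkC q) ⊗ₜ[T₀] (1 : k) := by
    intro q
    change (α.comp (MvPolynomial.map (algebraMap T k))) q =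
      (Algebra.TensorProduct.includeLeftRingHom.comp
        ((algebraMap C Λ).comp (mkC : MvPolynomial (Fin n) T →+* C))) q
    congr 1
    refine MvPolynomial.ringHom_ext (fun t => ?_) (fun i => ?_)
    · change α (MvPolynomial.map (algebraMap T k) (MvPolynomial.C t)) =
        algebraMap C Λ (mkC (MvPolynomial.C t)) ⊗ₜ[T₀] (1 : k)
      rw [MvPolynomial.map_C, MvPolynomial.eval₂Hom_C, ← MvPolynomial.algebraMap_eq,
        AlgHom.commutes, ← IsScalarTower.algebraMap_apply T C Λ,
        IsScalarTower.algebraMap_apply T T₀ Λ, IsScalarTower.algebraMap_apply T T₀ k,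
        ← Algebra.TensorProduct.algebraMap_apply]
      exact (Algebra.TensorProduct.algebraMap_apply' (R := T₀) (A := Λ) (B := k) _).symm
    · change α (MvPolynomial.map (algebraMap T k) (MvPolynomial.X i)) =
        algebraMap C Λ (mkC (MvPolynomial.X i)) ⊗ₜ[T₀] (1 : k)
      rw [MvPolynomial.map_X, MvPolynomial.eval₂Hom_X']
  -- `α` is onto
  have hαsurj : Function.Surjective α := by
    intro z
    induction z using TensorProduct.induction_on with
    | zero => exact ⟨0, map_zero α⟩
    | tmul a b =>
      obtain ⟨c, rfl⟩ := Ideal.Quotient.mk_surjective a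
      obtain ⟨q, rfl⟩ := hmkC c
      refine ⟨MvPolynomial.map (algebraMap T k) q * MvPolynomial.C b, ?_⟩
      rw [map_mul, hαmap, MvPolynomial.eval₂Hom_C, Ideal.Quotient.algebraMap_eq]
      change _ * ((1 : Λ) ⊗ₜ[T₀] b) = _
      rw [Algebra.TensorProduct.tmul_mul_tmul, mul_one, one_mul]
    | add x y hx hy =>
      obtain ⟨f, rfl⟩ := hx
      obtain ⟨f', rfl⟩ := hy
      exact ⟨f + f', map_add α f f'⟩
  -- `α` kills the `ḡ_l`
  have hαker : Ideal.span (Set.range fun l => MvPolynomial.map (algebraMap T k) (gT l)) ≤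
      RingHom.ker α := by
    rw [Ideal.span_le]
    rintro _ ⟨l, rfl⟩
    rw [SetLike.mem_coe, RingHom.mem_ker, hαmap, hgT, map_zero, TensorProduct.zero_tmul]
  -- `ψ` is bijective
  have hψinj : Function.Injective ψ := by
    rw [injective_iff_map_eq_zero]
    intro z hz
    obtain ⟨f, rfl⟩ := hαsurj z
    have hf : f ∈ RingHom.ker β := by
      rw [RingHom.mem_ker, ← hψα]
      exact hz
    exact hαker (hker hf)
  have hψsurj : Function.Surjective ψ := fun y => by
    obtain ⟨f, rfl⟩ := hgen y
    exact ⟨α f, DFunLike.congr_fun hψα f⟩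
  -- `ψ` is `Λ`-linear, hence a `Λ`-linear isomorphism `Λ ⊗_{T₀} k ≃ Λ₀`
  let ψΛ : M →ₗ[Λ] Λ₀ :=
    { toFun := ψ
      map_add' := fun x y => map_add ψ x y
      map_smul' := fun a z => by
        change ψ (a • z) = a • ψ z
        induction z using TensorProduct.induction_on with
        | zero => rw [smul_zero, map_zero, smul_zero]
        | add x y hx hy => rw [smul_add, map_add, map_add, hx, hy, smul_add]
        | tmul x y =>
          rw [TensorProduct.smul_tmul', hψ, hψ, smul_eq_mul, map_mul, Algebra.smul_def,
            mul_assoc] }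
  let e : M ≃ₗ[Λ] Λ₀ := LinearEquiv.ofBijective ψΛ ⟨hψinj, hψsurj⟩
  exact Module.Flat.of_linearEquiv e.symm

end FibreFlat

/-! ### The fibre of `B′ = R ⊗_T P` over `𝔪` is `k ⊗_T P` -/

section Pasting

/-- **Pasting of pushout squares for the fibre.** Let `T → R`, `P` a `T`-algebra and
`B′ = R ⊗_T P` (`Algebra.IsPushout T R P B′`); let `R → B → B′` factor the structure map and let
`𝔪 ⊆ R` be an ideal, `𝔪B` and `𝔪B′ = (𝔪B)B′` its extensions. Then `B′/𝔪B′ = R/𝔪 ⊗_T P`, for any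
`R/𝔪`-algebra structure on `B′/𝔪B′` compatible with `T`, `R` and `B/𝔪B` (the squares `R → R/𝔪`,
`B → B/𝔪B` and `B → B/𝔪B`, `B′ → B′/𝔪B′` are pushouts, `isPushout_quotient_map`, and pushouts
paste, `Algebra.IsPushout.comp_iff`). [folklore] -/
theorem isPushout_quotient_comp {T : Type*} {R : Type*} {P : Type*} {B : Type*} {B' : Type*}
    [CommRing T] [CommRing R] [CommRing P] [CommRing B] [CommRing B']
    [Algebra T R] [Algebra T P] [Algebra P B'] [Algebra R B'] [Algebra T B']
    [IsScalarTower T R B'] [IsScalarTower T P B'] [Algebra.IsPushout T R P B']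
    [Algebra R B] [Algebra B B'] [IsScalarTower R B B'] (𝔪 : Ideal R)
    [Algebra (R ⧸ 𝔪) (B' ⧸ (𝔪.map (algebraMap R B)).map (algebraMap B B'))]
    [IsScalarTower R (R ⧸ 𝔪) (B' ⧸ (𝔪.map (algebraMap R B)).map (algebraMap B B'))]
    [IsScalarTower T (R ⧸ 𝔪) (B' ⧸ (𝔪.map (algebraMap R B)).map (algebraMap B B'))]
    [IsScalarTower (R ⧸ 𝔪) (B ⧸ 𝔪.map (algebraMap R B))
      (B' ⧸ (𝔪.map (algebraMap R B)).map (algebraMap B B'))] :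
    Algebra.IsPushout T (R ⧸ 𝔪) P (B' ⧸ (𝔪.map (algebraMap R B)).map (algebraMap B B')) := by
  let 𝔪B := 𝔪.map (algebraMap R B)
  let E := B' ⧸ 𝔪B.map (algebraMap B B')
  -- the two quotient squares
  haveI h1 : Algebra.IsPushout R B (R ⧸ 𝔪) (B ⧸ 𝔪B) := (isPushout_quotient_map R B 𝔪).symm
  haveI h2 : Algebra.IsPushout B B' (B ⧸ 𝔪B) E := (isPushout_quotient_map B B' 𝔪B).symm
  haveI : IsScalarTower R (B ⧸ 𝔪B) E := IsScalarTower.of_algebraMap_eq fun r => by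
    rw [IsScalarTower.algebraMap_apply R B (B ⧸ 𝔪B), Ideal.Quotient.algebraMap_eq,
      Ideal.Quotient.algebraMap_quotient_map_quotient, ← IsScalarTower.algebraMap_apply,
      IsScalarTower.algebraMap_apply R B' E, Ideal.Quotient.algebraMap_eq]
  -- paste along `R → B → B′`
  haveI h3 : Algebra.IsPushout R B' (R ⧸ 𝔪) E :=
    (Algebra.IsPushout.comp_iff R B (R ⧸ 𝔪) (B ⧸ 𝔪B) (T := B') (T' := E)).mpr h2
  haveI h4 : Algebra.IsPushout R (R ⧸ 𝔪) B' E := h3.symm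
  -- paste along `T → R → R/𝔪`
  exact (Algebra.IsPushout.comp_iff T R P B' (T := R ⧸ 𝔪) (T' := E)).mpr h4

end Pasting

end Literature.RingTheory.Flat
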